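import Literature.MathematicalPhysics.QuantumFieldTheory.WilsonFinTorusMagneticFluxSectors
import HarnessLib

/-!
# Every 't Hooft twist is dominated by no twist on the anisotropic four-torus:
# `W{n_{μν}; a_μ} ≤ W{0; a_μ}` for all six central twists, by the transfer matrix (no reflection, odd sides allowed)

Topic `Literature/MathematicalPhysics/QuantumFieldTheory`; sequel of `WilsonFinTorusMagneticSliceKernel.lean` (the magnetically
twisted slice kernel `K^w_β`, the time slicing of 't Hooft's `W{z}` with one electrically twisted bond, the eigenbasis of `𝕋_m`)
and `WilsonFinTorusMagneticFluxSectors.lean` (`e^{−βF(e,m)} ≥ 0`), with the axis-exchange identities of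
`WilsonFinTorusTwistTensor.lean` (`…_swap03`: the cube step mixes electric and magnetic twists; `…_rotate`: 't Hooft's (6.1)).

THE RESULT.  Tomboulis–Yaffe ∕ Kanazawa: the twisted partition function is at most the untwisted one, `Z^{[k]} ≤ Z`
(Kanazawa, Ann. Phys. 324 (2009) §2 Lemma 2 eq. (17): `0 ≤ ⟨𝒪^{[k]}[𝒱]⟩ ≤ 1`, by site-reflection positivity; tree:
`twistedPartitionFunction_le_partitionFunction(_plane)` on the symmetric EVEN torus, one twisted plane).  Here, by the
TRANSFER MATRIX instead of reflections, for 't Hooft's FULL tensor (electric AND magnetic twists at once) on the ANISOTROPIC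
box with odd sides allowed:

* `wilsonFinTorusTensorTwistedPartition_le_eraseElectric` — **an electric twist never increases `W`**:
  `W{z}(b₁,b₂,b₃,M+2) ≤ W{z with electric part erased}(b₁,b₂,b₃,M+2)` for central electric entries and ARBITRARY magnetic ones
  (`β ≥ 0`, unitary continuous `ρ`): in the eigenbasis of the positive twisted transfer operator `𝕋_m`,
  `Tr(Ω[k]𝕋_m^{M+2}) = Σᵢ λᵢ^M gᵢ(k)` with `|gᵢ(k)| ≤ λᵢ² = gᵢ(0)` (`Literature.Analysis.OperatorTheory.integral_cyclic_twisted_le`);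
* ★ `wilsonFinTorusTensorTwistedPartition_le_partition` — **`W{z}(a,b,c,d) ≤ Z(a,b,c,d)` for every tensor `z` with central
  read entries**, every box with `a, c, d ≥ 2` (`β ≥ 0`): erase the electric twists (time `d`), read the axis `0` as time
  (`…_swap03`: the magnetic twists `(0,1), (0,2)` become electric) and erase them (time `a`), rotate by (6.1) (the remaining
  magnetic twist `(1,2)` becomes electric) and erase it (time `c`), and come back by the axis symmetry of `Z`;
* `wilsonFinTorusTensorTwistedPartition_eq_partition_of_forall_eq_one` (`W{1} = Z`), `wilsonFinTorusPartition_perm_bdac`;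
* corollaries for 't Hooft's flux free energies: `re_wilsonFinTorusFluxTransform_le_partition` — **`0 ≤ e^{−F}(e | m; a,b,c,M+2)
  ≤ Z(a,b,c,M+2)`**, i.e. after 't Hooft's normalisation by `W{0,0}`: `F(e, m; a, β) ≥ 0` for EVERY electric and magnetic
  flux (`a, c ≥ 2`); `re_wilsonFinTorusMagneticFluxPartition_le_partition` (the `Γ`-family version).

HONEST FRAMING: finite-box inequalities at fixed `β ≥ 0`; `F(e,m) ≥ 0` is the weakest possible statement about flux free
energies (no rate, no volume dependence) — nothing here bears on `a_i → ∞`, heavy∕light fluxes ('t Hooft §7), the string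
tension, confinement or a mass gap.  The Yang–Mills mass gap (Clay) is NOT proved by any of this; R4 closes only the conditional
finite-𝕋⁴ rung `BalabanLadder.UV`.  Theorem-only file: no `def`, no `instance`, no `sorry`; standard axioms.

References: G. 't Hooft, Nucl. Phys. B 153 (1979) 141, §§2, 5, 6; E. T. Tomboulis, L. G. Yaffe, Commun. Math. Phys. 100 (1985)
313; T. Kanazawa, Ann. Phys. 324 (2009) 1634, §2 Lemma 2; M. Lüscher, Commun. Math. Phys. 54 (1977) 283; I. Montvay, G. Münster
(1994) §3.2.6 (3.145)–(3.146).
-/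

noncomputable section

open MeasureTheory Filter Function Finset
open scoped ENNReal ComplexConjugate BigOperators
open Literature.Analysis.OperatorTheory

namespace Literature.MathematicalPhysics.QuantumFieldTheory

variable {G : Type*} [Group G] [TopologicalSpace G] [IsTopologicalGroup G] [CompactSpace G]
  [MeasurableSpace G] [BorelSpace G] {N : ℕ} (ρ : G →* Matrix (Fin N) (Fin N) ℂ)

/-! ### No twist read: `W{1} = Z`; an axis permutation of `Z` -/

/-- **A tensor whose six read entries are trivial gives Wilson's partition function**: if `z μ ν = 1` for all `μ < ν` then
`W{z}(n₀,n₁,n₂,n₃) = Z(n₀,n₁,n₂,n₃)`. [cite: tHooft1979Flux, §2 (2.6)] -/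
theorem wilsonFinTorusTensorTwistedPartition_eq_partition_of_forall_eq_one (β : ℝ) {z : Fin 4 → Fin 4 → G}
    (hz : ∀ μ ν : Fin 4, μ < ν → z μ ν = 1) (n₀ n₁ n₂ n₃ : ℕ) :
    wilsonFinTorusTensorTwistedPartition ρ β z n₀ n₁ n₂ n₃ = wilsonFinTorusPartition ρ β n₀ n₁ n₂ n₃ := by
  unfold wilsonFinTorusTensorTwistedPartition wilsonFinTorusPlaqTwistedPartition wilsonFinTorusPartition
  refine integral_congr_ae (ae_of_all _ fun U => ?_)
  simp only
  congr 1; congr 1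
  refine Finset.sum_congr rfl fun x _ => Finset.sum_congr rfl fun q _ => ?_
  have h1 : tHooftTwistTensor z x q.1.1 q.1.2 = 1 := by
    unfold tHooftTwistTensor
    split
    · exact hz _ _ q.2
    · rfl
  rw [h1, one_mul]

/-- `Z(b,d,a,c) = Z(a,b,c,d)` (the axis permutation used below; five transpositions of `WilsonFinTorusPartitionSymmetry.lean`).
[cite: MontvayMunster1994, §3.2.6 (3.145)] -/
theorem wilsonFinTorusPartition_perm_bdac (hρ : Continuous ρ) (β : ℝ) (a b c d : ℕ) :
    wilsonFinTorusPartition ρ β b d a c = wilsonFinTorusPartition ρ β a b c d := by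
  rw [wilsonFinTorusPartition_swap02 ρ hρ β b d a c, wilsonFinTorusPartition_swap01 ρ hρ β a d b c,
    wilsonFinTorusPartition_swap03 ρ hρ β d a b c, wilsonFinTorusPartition_swap02 ρ hρ β c a b d,
    wilsonFinTorusPartition_swap01 ρ hρ β b a c d]

section Spectral

variable [SecondCountableTopology G]

/-! ### An electric twist never increases `W` -/

/-- **An electric twist never increases the twisted functional integral**: for `β ≥ 0`, continuous unitary `ρ`, a tensor `z`
with CENTRAL electric entries `z μ 3` and ARBITRARY magnetic ones, and every box of time extent `M + 2`:
`W{z}(b₁,b₂,b₃,M+2) ≤ W{elecMagTwistTensor 1 z}(b₁,b₂,b₃,M+2)` — `Tr_m(Ω[k] 𝕋_m^{M+2}) ≤ Tr_m 𝕋_m^{M+2}`: in an eigenbasis of the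
positive operator `𝕋_m` the twisted trace is `Σᵢ λᵢ^M gᵢ(k)` with `|gᵢ(k)| ≤ λᵢ²`.  (The `m = 0`, symmetric-even-torus,
one-plane case is the tree's reflection-positivity theorem `twistedPartitionFunction_le_partitionFunction`.)
[cite: Kanazawa2008, §2 Lemma 2 eq. (17)–(18)] [cite: tHooft1979Flux, §5 (5.3)–(5.4)] [cite: Luscher1977] -/
theorem wilsonFinTorusTensorTwistedPartition_le_eraseElectric (hρ : Continuous ρ)
    (hρu : ∀ g, ρ g ∈ Matrix.unitaryGroup (Fin N) ℂ) {β : ℝ} (hβ : 0 ≤ β) {z : Fin 4 → Fin 4 → G}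
    (hz : ∀ i : Fin 3, z i.castSucc 3 ∈ Subgroup.center G) (b₁ b₂ b₃ M : ℕ) :
    wilsonFinTorusTensorTwistedPartition ρ β z b₁ b₂ b₃ (M + 2) ≤
      wilsonFinTorusTensorTwistedPartition ρ β (elecMagTwistTensor (1 : Fin 4 → G) z) b₁ b₂ b₃ (M + 2) := by
  haveI : IsFiniteMeasure (haarProbability G) := by
    dsimp [haarProbability]; infer_instance
  obtain ⟨C, A, s, hcnt, b, lam, i₀, hC, hA, hb, hlam, -, -⟩ :=
    exists_eigenbasis_finTorusSliceKernelTw hρ hρu hβ (finSliceTwistTensor z : FinSpatialSite b₁ b₂ b₃ → Fin 3 → Fin 3 → G)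
  haveI : Countable s := hcnt
  have hK := stronglyMeasurable_uncurry_finTorusSliceKernelTw (b₁ := b₁) (b₂ := b₂) (b₃ := b₃) ρ hρ β
    (finSliceTwistTensor z)
  have hsymm : ∀ x y : FinSpatialSite b₁ b₂ b₃ × Fin 3 → G,
      finTorusSliceKernelTw ρ β (finSliceTwistTensor z) x y = finTorusSliceKernelTw ρ β (finSliceTwistTensor z) y x :=
    finTorusSliceKernelTw_symm ρ hρu β _
  have hz1 : ∀ i : Fin 3, elecMagTwistTensor (1 : Fin 4 → G) z i.castSucc 3 ∈ Subgroup.center G := fun i => by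
    rw [elecMagTwistTensor_three, Pi.one_apply]
    exact Subgroup.one_mem _
  have h1 : (fun μ => elecMagTwistTensor (1 : Fin 4 → G) z μ 3) = (1 : Fin 4 → G) :=
    funext fun μ => by rw [elecMagTwistTensor_three]
  rw [wilsonFinTorusTensorTwistedPartition_add_two_eq_integral_cyclic ρ hρ β hz b₁ b₂ b₃ M,
    wilsonFinTorusTensorTwistedPartition_add_two_eq_integral_cyclic ρ hρ β hz1 b₁ b₂ b₃ M,
    finSliceTwistTensor_elecMagTwistTensor, h1, finSliceTwist_one]
  exact integral_cyclic_twisted_le hK hC hsymm hA hb (fun i => (hlam i).1)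
    (measurePreserving_finSliceTwist (fun μ => z μ 3)) M

/-! ### All six twists: `W{z} ≤ Z` -/

/-- ★ **Every 't Hooft twist is dominated by no twist: `W{z}(a,b,c,d) ≤ Z(a,b,c,d)`** for every tensor `z : Fin 4 → Fin 4 → G`
whose six read entries `z μ ν` (`μ < ν`) are CENTRAL, every compact `G`, continuous unitary `ρ`, `β ≥ 0`, and every box with
`a, c, d ≥ 2` — all electric AND magnetic twists at once, anisotropic box, odd sides allowed.  Route: erase the electric twists
(time `d`); the cube step `…_swap03` turns the magnetic twists `(0,1), (0,2)` into electric ones of the box `(d,b,c,a)`, erase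
them (time `a`); 't Hooft's rotation `…_rotate` turns the remaining magnetic twist `(1,2)` into an electric one of `(b,d,a,c)`,
erase it (time `c`); `W{1} = Z` and `Z(b,d,a,c) = Z(a,b,c,d)`.  (Tomboulis–Yaffe ∕ Kanazawa `Z^{[k]} ≤ Z` by reflection
positivity: tree `twistedPartitionFunction_le_partitionFunction_plane`, symmetric even torus, one plane.)
[cite: Kanazawa2008, §2 Lemma 2 eq. (17)–(18)] [cite: TomboulisYaffe1985] [cite: tHooft1979Flux, §5 (5.4) and §6 (6.1)–(6.2)] -/
theorem wilsonFinTorusTensorTwistedPartition_le_partition (hρ : Continuous ρ)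
    (hρu : ∀ g, ρ g ∈ Matrix.unitaryGroup (Fin N) ℂ) {β : ℝ} (hβ : 0 ≤ β) {z : Fin 4 → Fin 4 → G}
    (hz : ∀ μ ν : Fin 4, μ < ν → z μ ν ∈ Subgroup.center G) {a b c d : ℕ} (ha : 2 ≤ a) (hc : 2 ≤ c) (hd : 2 ≤ d) :
    wilsonFinTorusTensorTwistedPartition ρ β z a b c d ≤ wilsonFinTorusPartition ρ β a b c d := by
  obtain ⟨Ma, rfl⟩ : ∃ M, a = M + 2 := ⟨a - 2, by omega⟩
  obtain ⟨Mc, rfl⟩ : ∃ M, c = M + 2 := ⟨c - 2, by omega⟩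
  obtain ⟨Md, rfl⟩ : ∃ M, d = M + 2 := ⟨d - 2, by omega⟩
  -- the three tensors met along the route
  set z₁ : Fin 4 → Fin 4 → G := elecMagTwistTensor (1 : Fin 4 → G) z with hz₁
  set z₂ : Fin 4 → Fin 4 → G := elecMagTwistTensor (1 : Fin 4 → G) (swap03TwistTensor z₁) with hz₂
  set z₃ : Fin 4 → Fin 4 → G := elecMagTwistTensor (1 : Fin 4 → G) (rotateTwistTensor z₂) with hz₃
  have hzE : ∀ i : Fin 3, z i.castSucc 3 ∈ Subgroup.center G := fun i => hz _ _ (Fin.castSucc_lt_last i)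
  have hz₁E : ∀ i : Fin 3, swap03TwistTensor z₁ i.castSucc 3 ∈ Subgroup.center G := by
    intro i
    fin_cases i
    · simp [hz₁, swap03TwistTensor, elecMagTwistTensor]
    · simpa [hz₁, swap03TwistTensor, elecMagTwistTensor] using Subgroup.inv_mem _ (hz 0 1 (by decide))
    · simpa [hz₁, swap03TwistTensor, elecMagTwistTensor] using Subgroup.inv_mem _ (hz 0 2 (by decide))
  have hz₂E : ∀ i : Fin 3, rotateTwistTensor z₂ i.castSucc 3 ∈ Subgroup.center G := by
    intro i
    fin_cases i
    · simpa [hz₂, hz₁, rotateTwistTensor, swap03TwistTensor, elecMagTwistTensor] using hz 1 2 (by decide)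
    · simp [hz₂, hz₁, rotateTwistTensor, swap03TwistTensor, elecMagTwistTensor]
    · simp [hz₂, hz₁, rotateTwistTensor, swap03TwistTensor, elecMagTwistTensor]
  have hz₃1 : ∀ μ ν : Fin 4, μ < ν → z₃ μ ν = 1 := by
    intro μ ν hμν
    fin_cases μ <;> fin_cases ν <;>
      simp (config := { decide := true }) [hz₃, hz₂, hz₁, rotateTwistTensor, swap03TwistTensor, elecMagTwistTensor] at hμν ⊢
  calc wilsonFinTorusTensorTwistedPartition ρ β z (Ma + 2) b (Mc + 2) (Md + 2)
      ≤ wilsonFinTorusTensorTwistedPartition ρ β z₁ (Ma + 2) b (Mc + 2) (Md + 2) :=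
        wilsonFinTorusTensorTwistedPartition_le_eraseElectric ρ hρ hρu hβ hzE _ _ _ _
    _ = wilsonFinTorusTensorTwistedPartition ρ β (swap03TwistTensor z₁) (Md + 2) b (Mc + 2) (Ma + 2) :=
        wilsonFinTorusTensorTwistedPartition_swap03 ρ hρ β z₁ _ _ _ _
    _ ≤ wilsonFinTorusTensorTwistedPartition ρ β z₂ (Md + 2) b (Mc + 2) (Ma + 2) :=
        wilsonFinTorusTensorTwistedPartition_le_eraseElectric ρ hρ hρu hβ hz₁E _ _ _ _
    _ = wilsonFinTorusTensorTwistedPartition ρ β (rotateTwistTensor z₂) b (Md + 2) (Ma + 2) (Mc + 2) :=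
        wilsonFinTorusTensorTwistedPartition_rotate ρ hρ β z₂ _ _ _ _
    _ ≤ wilsonFinTorusTensorTwistedPartition ρ β z₃ b (Md + 2) (Ma + 2) (Mc + 2) :=
        wilsonFinTorusTensorTwistedPartition_le_eraseElectric ρ hρ hρu hβ hz₂E _ _ _ _
    _ = wilsonFinTorusPartition ρ β b (Md + 2) (Ma + 2) (Mc + 2) :=
        wilsonFinTorusTensorTwistedPartition_eq_partition_of_forall_eq_one ρ β hz₃1 _ _ _ _
    _ = wilsonFinTorusPartition ρ β (Ma + 2) b (Mc + 2) (Md + 2) := wilsonFinTorusPartition_perm_bdac ρ hρ β _ _ _ _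

/-- **`W{k, m; a_μ} ≤ W{0, 0; a_μ}` in 't Hooft's labels**: for a hom-like centre-valued twist map `φ : Γ → Z(G)` (`φ 0 = 1` not
even needed here, only centrality) and all labels `k₀ k₁ k₂ m₁₂ m₀₂ m₀₁`, on every box with `a, c, d ≥ 2`.
[cite: tHooft1979Flux, §2 (2.6) and §5 (5.4)] [cite: Kanazawa2008, §2 Lemma 2 eq. (17)–(18)] -/
theorem wilsonFinTorusTensorTwistedPartition_twistIdx_le_partition (hρ : Continuous ρ)
    (hρu : ∀ g, ρ g ∈ Matrix.unitaryGroup (Fin N) ℂ) {β : ℝ} (hβ : 0 ≤ β) {Γ : Type*} [AddCommGroup Γ] {φ : Γ → G}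
    (hφc : ∀ k, φ k ∈ Subgroup.center G) (k₀ k₁ k₂ m₁₂ m₀₂ m₀₁ : Γ) {a b c d : ℕ} (ha : 2 ≤ a) (hc : 2 ≤ c)
    (hd : 2 ≤ d) :
    wilsonFinTorusTensorTwistedPartition ρ β (fun μ ν => φ (twistIdx k₀ k₁ k₂ m₁₂ m₀₂ m₀₁ μ ν)) a b c d ≤
      wilsonFinTorusPartition ρ β a b c d :=
  wilsonFinTorusTensorTwistedPartition_le_partition ρ hρ hρu hβ (fun _ _ _ => hφc _) ha hc hd

/-! ### 't Hooft's flux free energies are non-negative: `0 ≤ e^{−F}(e | m) ≤ Z` -/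

/-- **`Re Z_{ψ,m}(a,b,c,M+2) ≤ Z(a,b,c,M+2)`** for the `Γ`-family flux sectors at any central magnetic twist tensor (`a, c ≥ 2`):
the electric sectors are `≥ 0` and sum to `W{0,m}`, which is at most `Z`. [cite: tHooft1979Flux, §5 (5.4)]
[cite: Kanazawa2008, §2 Lemma 2 eq. (17)–(18)] -/
theorem re_wilsonFinTorusMagneticFluxPartition_le_partition (hρ : Continuous ρ)
    (hρu : ∀ g, ρ g ∈ Matrix.unitaryGroup (Fin N) ℂ) {β : ℝ} (hβ : 0 ≤ β) {zM : Fin 4 → Fin 4 → G}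
    (hzM : ∀ μ ν : Fin 4, μ < ν → zM μ ν ∈ Subgroup.center G) {Γ : Type*} [AddCommGroup Γ] [Fintype Γ]
    {φ : Γ → Fin 4 → G} (hφ0 : φ 0 = 1) (hφadd : ∀ k k', φ (k + k') = φ k * φ k')
    (hφc : ∀ k (i : Fin 3), φ k i.castSucc ∈ Subgroup.center G) (ψ : AddChar Γ ℂ) {a b c : ℕ} (ha : 2 ≤ a) (hc : 2 ≤ c)
    (M : ℕ) :
    (wilsonFinTorusMagneticFluxPartition ρ β zM φ ψ a b c (M + 2)).re ≤ wilsonFinTorusPartition ρ β a b c (M + 2) := by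
  refine (re_wilsonFinTorusMagneticFluxPartition_le ρ hρ hρu hβ zM hφ0 hφadd hφc ψ a b c M).trans ?_
  refine wilsonFinTorusTensorTwistedPartition_le_partition ρ hρ hρu hβ (fun μ ν hμν => ?_) ha hc (by omega)
  unfold elecMagTwistTensor
  split
  · simp
  · exact hzM μ ν hμν

/-- ★ **'t Hooft's flux free energies are non-negative: `0 ≤ e^{−F}(e | m; a,b,c,M+2) ≤ Z(a,b,c,M+2)`** — i.e. after his
normalisation by `W{0, 0; a_μ} = Z`, `F(e, m; a, β) ≥ 0` for EVERY electric flux `(ψ₀,ψ₁,ψ₂)` and EVERY magnetic flux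
`(m₁₂,m₀₂,m₀₁)`; hom-like centre-valued `φ`, `β ≥ 0`, continuous unitary `ρ`, compact `G`, `a, c ≥ 2`.  (The lower bound is
`wilsonFinTorusFluxTransform_nonneg`.) [cite: tHooft1979Flux, §5 (5.1)–(5.4)] [cite: Kanazawa2008, §2 Lemma 2 eq. (17)–(18)]
[cite: TomboulisYaffe1985] -/
theorem re_wilsonFinTorusFluxTransform_le_partition (hρ : Continuous ρ) (hρu : ∀ g, ρ g ∈ Matrix.unitaryGroup (Fin N) ℂ)
    {β : ℝ} (hβ : 0 ≤ β) {Γ : Type*} [AddCommGroup Γ] [Fintype Γ] {φ : Γ → G} (hφ0 : φ 0 = 1)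
    (hφadd : ∀ k k', φ (k + k') = φ k * φ k') (hφc : ∀ k, φ k ∈ Subgroup.center G) (ψ₀ ψ₁ ψ₂ : AddChar Γ ℂ)
    (m₁₂ m₀₂ m₀₁ : Γ) {a b c : ℕ} (ha : 2 ≤ a) (hc : 2 ≤ c) (M : ℕ) :
    (wilsonFinTorusFluxTransform ρ β φ ψ₀ ψ₁ ψ₂ m₁₂ m₀₂ m₀₁ a b c (M + 2)).re ≤ wilsonFinTorusPartition ρ β a b c (M + 2) :=
  (re_wilsonFinTorusFluxTransform_le ρ hρ hρu hβ hφ0 hφadd hφc ψ₀ ψ₁ ψ₂ m₁₂ m₀₂ m₀₁ a b c M).trans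
    (wilsonFinTorusTensorTwistedPartition_twistIdx_le_partition ρ hρ hρu hβ hφc 0 0 0 m₁₂ m₀₂ m₀₁ ha hc (by omega))

end Spectral

end Literature.MathematicalPhysics.QuantumFieldTheory

end
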